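import Literature.AlgebraicGeometry.ModuliOfAbelianVarieties.SiegelAdmissibleClassUnique
import Literature.AlgebraicGeometry.ModuliOfAbelianVarieties.SiegelAdelicMarkingOfAnalytification
import Literature.Geometry.Kaehler.ComplexTorusCoveringSpaces
import Literature.Geometry.Kaehler.ComplexTorusSiegelNormalForm
import HarnessLib

/-!
# Re-basing a marking by `[J, r]`, `r ∈ K_δ(1)`, to basis matrix `γ = 1` (U-e P4b leaf (R0))

Topic `AlgebraicGeometry/ModuliOfAbelianVarieties`; namespace `Literature.AlgebraicGeometry.ModuliOfAbelianVarieties`.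
KERNEL ONLY: theorems; no definition, no named fact, no instance, no `sorry`.  Cell `hodgecm-mathlib` (D-0151), rung-0
(U)-road, U-e socket P4b (P4 lead B-p03 (g13), GO (R0) 15:08:49Z): the admissibility marking of ★ `IsAdmissibleAt` has an
arbitrary basis matrix `γ` of `Λ_r`; for an INTEGRAL representative `r ∈ K_δ(1) = GSp_δ(ẑ)` one has `Λ_r = ℤ^{2g}`
(★ `latticeOfGL_coe_eq_one_of_mem_principalLevelSubgroup_one`), so `γ ∈ GL_{2g}(ℤ)` and the marking can be RE-BASED to
`γ = 1` without changing its torsion parametrisation `u = m.r`: new chart `Ψ′ = Ψ ∘ γ⁻¹_ℝ` (★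
`ComplexTorus.sublatticePeriod`), new uniformisation `m.toFun ∘ ρ(γ⁻¹)` (★ `exists_homeomorph_of_baseChange` with identity
analytic representation).  This is the `γ = 1` normalisation assumed by ★ (G₀) `intGram_eq_typeForm_of_symplecticLift`,
★ (B4) `exists_pairingRead_forall_of_intGram_eq_typeForm` and the P4b sockets at the base point.  HC_CM is proved only modulo
the 7 printed citations until rung 0 closes; nothing here changes that count (books 0).

PRINT. [Milne2005ShimuraVarieties] §4 pp. 48–49 («`Λ_{au} = Λ_a` for `u ∈ GL_n(ẑ)`», `Λ_1 = ℤⁿ`), §6 Thm. 6.11 p. 74 (the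
marking `a : H₁(A, ℤ) ≅ Λ`); [Lange2023AbelianVarietiesComplex] §1.1.2 Prop. 1.1.6 (p. 8) (`ρ(P)`, `P ∈ GL(ℤ)`, is an
isomorphism with `ℂ`-linear analytic representation).

* `exists_intMatrix_of_isLatticeBasis_of_mem_one` — `IsLatticeBasis r γ`, `r ∈ K_δ(1)` ⇒ `γ = P`, `γ⁻¹ = Q` for integer
  matrices `P, Q` with `P Q = Q P = 1`;
* **`SiegelAdelicMarking.exists_rebase_γ_eq_one`** — `r ∈ K_δ(1)` ⇒ every marking `m` by `[J, r]` has a re-based marking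
  `m′` by `[J, r]` with `m′.γ = 1` and the SAME torsion parametrisation, `m′.r = m.r` (plus: `m′.toFun` is `m.toFun`
  composed with the additive biholomorphism `ρ(γ⁻¹)`).

## References
* [Milne2005ShimuraVarieties] J. S. Milne, *Introduction to Shimura Varieties* (2005), §4 pp. 48–49, §6 Thm. 6.11 p. 74.
* [Lange2023AbelianVarietiesComplex] H. Lange, *Abelian Varieties over the Complex Numbers* (2023), §1.1.2 Prop. 1.1.6 (p. 8).
-/

set_option autoImplicit false

noncomputable section

-- `ComplexTorus Φ` (for `Φ : ℝ^ι ≃ E`) is the type `ι → ℝ/ℤ`; instance paths up to unfolding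
set_option backward.isDefEq.respectTransparency false

open scoped Manifold ContDiff Matrix
open Matrix CategoryTheory
open Literature.AlgebraicGeometry.Motives (AbelianVariety ComplexPoints)
open Literature.Geometry.Kaehler (ComplexTorus)
open Literature.Geometry.Kaehler.ComplexTorus (proj mapMatrix)
open Literature.NumberTheory.Transcendental (IsAnalytification)
open Literature.NumberTheory.Adeles

namespace Literature.AlgebraicGeometry.ModuliOfAbelianVarieties

variable {g : ℕ} {δ : Fin g → ℕ}

/-- **A basis matrix of `Λ_r` for integral `r ∈ K_δ(1)` is unimodular**: `Λ_r = ℤ^{2g}` (★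
`latticeOfGL_coe_eq_one_of_mem_principalLevelSubgroup_one`) and `Λ_r = γℤ^{2g}` (★ `isLatticeBasis_iff_latticeOfGL_eq`)
give integer matrices `P = γ`, `Q = γ⁻¹` with `P Q = Q P = 1`. [cite: Milne2005ShimuraVarieties, §4 pp. 48–49 and §6 p. 75] -/
theorem exists_intMatrix_of_isLatticeBasis_of_mem_one {r : gspFinAdelic δ} (hr : r ∈ principalLevelSubgroup δ 1)
    {γ : GL (Fin g ⊕ Fin g) ℚ} (hγ : IsLatticeBasis r γ) :
    ∃ P Q : Matrix (Fin g ⊕ Fin g) (Fin g ⊕ Fin g) ℤ,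
      P.map (Int.cast : ℤ → ℚ) = (γ : Matrix (Fin g ⊕ Fin g) (Fin g ⊕ Fin g) ℚ) ∧
      Q.map (Int.cast : ℤ → ℚ) = ((γ⁻¹ : GL (Fin g ⊕ Fin g) ℚ) : Matrix (Fin g ⊕ Fin g) (Fin g ⊕ Fin g) ℚ) ∧
      P * Q = 1 ∧ Q * P = 1 := by
  classical
  have hL : latticeOfGL (Matrix.GeneralLinearGroup.map (algebraMap ℚ finAdeleQ) γ) =
      latticeOfGL (1 : GL (Fin g ⊕ Fin g) finAdeleQ) := by
    rw [← (isLatticeBasis_iff_latticeOfGL_eq r γ).1 hγ, latticeOfGL_coe_eq_one_of_mem_principalLevelSubgroup_one hr]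
  -- integrality of `γ`: its columns `γ e_j` lie in `Λ_γ = Λ_1 = ℤ^{2g}`
  have hP : ∀ i j, ∃ z : ℤ, (z : ℚ) = (γ : Matrix (Fin g ⊕ Fin g) (Fin g ⊕ Fin g) ℚ) i j := by
    intro i j
    have hcol : ((γ : Matrix (Fin g ⊕ Fin g) (Fin g ⊕ Fin g) ℚ) *ᵥ fun k => ((Pi.single j (1 : ℤ) : _ → ℤ) k : ℚ)) ∈
        latticeOfGL (1 : GL (Fin g ⊕ Fin g) finAdeleQ) := by
      rw [← hL, mem_latticeOfGL_map_iff_exists]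
      exact ⟨Pi.single j 1, rfl⟩
    obtain ⟨z, hz⟩ := (mem_latticeOfGL_one_iff.1 hcol) i
    refine ⟨z, ?_⟩
    rw [hz]
    have hv : (fun k => ((Pi.single j (1 : ℤ) : Fin g ⊕ Fin g → ℤ) k : ℚ)) = Pi.single j (1 : ℚ) := by
      funext k
      by_cases hk : k = j
      · subst hk; simp
      · simp [hk]
    rw [hv, Matrix.mulVec_single_one]
    rfl
  -- integrality of `γ⁻¹`: `e_j ∈ ℤ^{2g} = Λ_γ`, so `γ⁻¹ e_j` is integral
  have hQ : ∀ i j, ∃ z : ℤ, (z : ℚ) = ((γ⁻¹ : GL (Fin g ⊕ Fin g) ℚ) : Matrix (Fin g ⊕ Fin g) (Fin g ⊕ Fin g) ℚ) i j := by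
    intro i j
    have hej : (Pi.single j (1 : ℚ) : Fin g ⊕ Fin g → ℚ) ∈
        latticeOfGL (Matrix.GeneralLinearGroup.map (algebraMap ℚ finAdeleQ) γ) := by
      rw [hL, mem_latticeOfGL_one_iff]
      intro k
      by_cases hk : k = j
      · subst hk; exact ⟨1, by simp⟩
      · exact ⟨0, by simp [hk]⟩
    obtain ⟨z, hz⟩ := (mem_latticeOfGL_map_iff γ _).1 hej i
    refine ⟨z, ?_⟩
    rw [hz, Matrix.mulVec_single_one]
    rfl
  choose P hP' using hP
  choose Q hQ' using hQ
  have hPm : (Matrix.of fun i j => P i j).map (Int.cast : ℤ → ℚ) = (γ : Matrix (Fin g ⊕ Fin g) (Fin g ⊕ Fin g) ℚ) := by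
    ext i j; exact hP' i j
  have hQm : (Matrix.of fun i j => Q i j).map (Int.cast : ℤ → ℚ) =
      ((γ⁻¹ : GL (Fin g ⊕ Fin g) ℚ) : Matrix (Fin g ⊕ Fin g) (Fin g ⊕ Fin g) ℚ) := by
    ext i j; exact hQ' i j
  have hinj : Function.Injective (fun M : Matrix (Fin g ⊕ Fin g) (Fin g ⊕ Fin g) ℤ => M.map (Int.cast : ℤ → ℚ)) :=
    Matrix.map_injective Int.cast_injective
  refine ⟨Matrix.of fun i j => P i j, Matrix.of fun i j => Q i j, hPm, hQm, hinj ?_, hinj ?_⟩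
  · change (Matrix.of (fun i j => P i j) * Matrix.of fun i j => Q i j).map (Int.cast : ℤ → ℚ) =
      (1 : Matrix _ _ ℤ).map (Int.cast : ℤ → ℚ)
    rw [show (Int.cast : ℤ → ℚ) = ⇑(Int.castRingHom ℚ) from rfl, Matrix.map_mul]
    change (Matrix.of fun i j => P i j).map (Int.cast : ℤ → ℚ) * (Matrix.of fun i j => Q i j).map (Int.cast : ℤ → ℚ) = _
    rw [hPm, hQm, ← Units.val_mul, mul_inv_cancel, Units.val_one]
    exact (Matrix.map_one _ (map_zero _) (map_one _)).symm
  · change (Matrix.of (fun i j => Q i j) * Matrix.of fun i j => P i j).map (Int.cast : ℤ → ℚ) =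
      (1 : Matrix _ _ ℤ).map (Int.cast : ℤ → ℚ)
    rw [show (Int.cast : ℤ → ℚ) = ⇑(Int.castRingHom ℚ) from rfl, Matrix.map_mul]
    change (Matrix.of fun i j => Q i j).map (Int.cast : ℤ → ℚ) * (Matrix.of fun i j => P i j).map (Int.cast : ℤ → ℚ) = _
    rw [hPm, hQm, ← Units.val_mul, inv_mul_cancel, Units.val_one]
    exact (Matrix.map_one _ (map_zero _) (map_one _)).symm

namespace SiegelAdelicMarking

variable {J : C0pm δ} {r : gspFinAdelic δ} {A : AbelianVariety ℂ}

/-- **RE-BASING A MARKING BY `[J, r]`, `r ∈ K_δ(1)`, TO `γ = 1`** — U-e P4b leaf (R0).  For `r ∈ K_δ(1)` and a marking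
`m` of `A` by `[J, r]` (basis matrix `γ`, chart `Ψ`, uniformisation `u`): there is a marking `m′` by `[J, r]` with
`m′.γ = 1`, chart `m′.Ψ = Ψ ∘ (γ⁻¹)_ℝ` (★ `ComplexTorus.sublatticePeriod Ψ Q`, `Q = γ⁻¹ ∈ GL_{2g}(ℤ)`), uniformisation
`u ∘ ρ(γ⁻¹)` (★ `exists_homeomorph_of_baseChange`, identity analytic representation), and the SAME torsion parametrisation:
`m′.r v = m.r v` for all `v ∈ ℚ^{2g}`. [cite: Milne2005ShimuraVarieties, §6 Thm. 6.11 p. 74 and §4 pp. 48–49]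
[cite: Lange2023AbelianVarietiesComplex, §1.1.2 Prop. 1.1.6 (p. 8)] -/
theorem exists_rebase_γ_eq_one (hr : r ∈ principalLevelSubgroup δ 1) (m : SiegelAdelicMarking J r A) :
    ∃ m' : SiegelAdelicMarking J r A, m'.γ = 1 ∧
      (∃ (Q : Matrix (Fin g ⊕ Fin g) (Fin g ⊕ Fin g) ℤ) (hQ : Q.det ≠ 0),
        Q.map (Int.cast : ℤ → ℚ) = ((m.γ⁻¹ : GL (Fin g ⊕ Fin g) ℚ) : Matrix (Fin g ⊕ Fin g) (Fin g ⊕ Fin g) ℚ) ∧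
        m'.Ψ = ComplexTorus.sublatticePeriod m.Ψ Q hQ ∧
        ∀ t, m'.toFun t = m.toFun (mapMatrix m'.Ψ m.Ψ Q t)) ∧
      ∀ v, m'.r v = m.r v := by
  classical
  obtain ⟨P, Q, hP, hQ, hPQ, hQP⟩ := exists_intMatrix_of_isLatticeBasis_of_mem_one hr m.γ_isLatticeBasis
  have hQunit : IsUnit Q.det := by
    have h : Q.det * P.det = 1 := by rw [← Matrix.det_mul, hQP, Matrix.det_one]
    exact IsUnit.of_mul_eq_one _ h
  have hQdet : Q.det ≠ 0 := hQunit.ne_zero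
  -- the re-based chart and the isomorphism `ρ(Q) : ℝ^{2g}/ℤ^{2g} (chart Ψ ∘ Q_ℝ) → ℝ^{2g}/ℤ^{2g} (chart Ψ)`
  set Ψ' : (Fin g ⊕ Fin g → ℝ) ≃L[ℝ] (Fin g → ℂ) := ComplexTorus.sublatticePeriod m.Ψ Q hQdet with hΨ'
  obtain ⟨e, he, -, headd, hehol, -⟩ := ComplexTorus.exists_homeomorph_of_baseChange Ψ' m.Ψ Q P hQP hPQ
    (ContinuousLinearEquiv.refl ℝ (Fin g → ℂ)) (fun u => rfl) (fun x => by
      rw [ContinuousLinearEquiv.refl_apply, hΨ', ComplexTorus.sublatticePeriod_apply])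
  -- the real matrix of `Q` is that of `γ⁻¹`
  have hQreal : Q.map (Int.cast : ℤ → ℝ) =
      (((m.γ⁻¹ : GL (Fin g ⊕ Fin g) ℚ) : Matrix (Fin g ⊕ Fin g) (Fin g ⊕ Fin g) ℚ).map (algebraMap ℚ ℝ)) := by
    ext i j
    rw [Matrix.map_apply, Matrix.map_apply, eq_ratCast, ← hQ, Matrix.map_apply, Rat.cast_intCast]
  have hΨ'apply : ∀ x, Ψ' x =
      m.Ψ ((((m.γ⁻¹ : GL (Fin g ⊕ Fin g) ℚ) : Matrix (Fin g ⊕ Fin g) (Fin g ⊕ Fin g) ℚ).map (algebraMap ℚ ℝ)) *ᵥ x) :=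
    fun x => by rw [hΨ', ComplexTorus.sublatticePeriod_apply, hQreal]
  have h1 : (((1 : GL (Fin g ⊕ Fin g) ℚ)⁻¹ : GL (Fin g ⊕ Fin g) ℚ) : Matrix (Fin g ⊕ Fin g) (Fin g ⊕ Fin g) ℚ).map
      (algebraMap ℚ ℝ) = 1 := by
    rw [inv_one, Units.val_one]; exact Matrix.map_one _ (map_zero _) (map_one _)
  refine ⟨{ γ := 1
            γ_isLatticeBasis := isLatticeBasis_one_of_mem_principalLevelSubgroup_one hr
            Ψ := Ψ'
            Ψ_J := fun x => ?_
            toFun := m.toFun ∘ e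
            isAnalytification :=
              m.isAnalytification.comp_of_isHomeomorph e.isHomeomorph (hehol.mdifferentiable (by simp)) rfl
            toFun_add := fun x y => by
              show m.toFun (e (x + y)) = m.toFun (e x) * m.toFun (e y)
              rw [headd, m.toFun_add] },
    rfl, ⟨Q, hQdet, hQ, rfl, fun t => by show m.toFun (e t) = m.toFun (mapMatrix Ψ' m.Ψ Q t); rw [he]⟩,
    fun v => ?_⟩
  · -- the complex-structure clause transported along `Q_ℝ = (γ⁻¹)_ℝ`
    rw [h1, Matrix.one_mulVec, Matrix.one_mulVec, hΨ'apply, hΨ'apply]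
    exact m.Ψ_J x
  · -- the torsion parametrisations agree
    rw [SiegelAdelicMarking.r_def, SiegelAdelicMarking.r_def]
    change m.toFun (e (proj Ψ' _)) = _
    rw [he, ComplexTorus.mapMatrix_proj, hQreal, inv_one, Units.val_one, Matrix.one_mulVec]
    congr 2
    funext i
    simp only [Matrix.mulVec, dotProduct, Matrix.map_apply, eq_ratCast, Rat.cast_sum, Rat.cast_mul]

end SiegelAdelicMarking

end Literature.AlgebraicGeometry.ModuliOfAbelianVarieties

end
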